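import Literature.NumberTheory.Automorphic.ArchInnerFormCartanAtlas     -- ★ p849656 (T-ATLAS) PART 2b (LH3-p03 (g2)): `gprimeTorus`, `gprimeBlock`, `splitChartPlaces` (+ PART 2a `boostStd`, `gprimeSplitGL`, `gprimeCptGL`)
import Literature.NumberTheory.Automorphic.ArchCartanCoordinates        -- ★ (COORD) (LH3-p01 (g3)): `negXAt`, `negXAt_apply_self`, `negXAt_apply_of_ne`
import HarnessLib

/-!
# The split reflection `x_w ↦ −x_w` IS REALISED in `G′_∞`: an involutive conjugating element for `gprimeTorus α S′ (negXAt w c)`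
# ((NEGX-CONJ) — LH3-plan (g2) deal 2026-09-02T06:18:04Z; Rogawski 1990 §3.6; Knapp 1986 V §3; Shelstad 1979 §4)

Topic `NumberTheory/Automorphic`; namespace `Literature.NumberTheory.Automorphic.UnitaryGroup`.  THEOREMS ONLY (no definition, no instance, no notation, no axiom, no named
fact, no `sorry`); kernel lane `--kind proof --supports stmt-HodgeConjecture-24833`.  Cell `pub/hodgecm-mathlib`, crux H413 (`stmt-HodgeConjecture-24833`), F0∕P3c line LH3,
DIRECT ROAD of `stub_N9` (archimedean endoscopic transfer); organ **(NEGX-CONJ)** of LH3-plan (g2) (asked for by LH7-p02 (g2)'s (L2-PWC) census (3)(b)); seat LH4-p01 (g2).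
Consumers: the (W)-clause `archBzWeyl_transfFam` (LH7-p02 ED. 2), `chartOrbG_negXAt` (LH3-p02), O-L2 — every «orbital integral on `G′_∞` at `negXAt w c` =
orbital integral at `c`» statement is conjugation-invariance composed with this file.  The `H_∞` twin (swap `J = Φ₂` at `w`) is ★ p849838 `ArchEndoscopicChartOrbWeyl`
(LH2-p04 (g3): `exists_conj_endoTorus_eq_negXAt`, `chartOrbH_negXAt`) and is NOT restated here.  Count-neutral chart bookkeeping.

THE MATHEMATICS.  At a SPLIT place `w` of a chart the torus element is hyperbolic on a plane and the Weyl reflection `x ↦ −x` of that plane is realised by an element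
of the REAL group (unlike the flip `θ₀ ↔ θ₂` at a compact place, which is only stable conjugacy):
* `G′_w = U(diag a)(ℂ)`, standard position `b = a ∘ τ`, boost `B(b; x, φ, θ) = (e^{iθ}cosh x, 0, e^{iθ} r sinh x; 0, e^{iφ}, 0; e^{iθ} r⁻¹ sinh x, 0, e^{iθ}cosh x)`
  (★ `boostStd`): the diagonal sign matrix `D = diag(1, 1, −1)` satisfies `D · B(b; x, φ, θ) = B(b; −x, φ, θ) · D` (`cosh` even, `sinh` odd; the off-plane entry and the
  diagonal are untouched) and `D ∈ U(diag b)(ℂ)` for EVERY real diagonal form (it is the compact-chart point `gprimeCptGL τ (0, 0, π)`: `e^{iπ} = −1` on the odd line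
  `τ 2`, `1` on the two even lines — ★ `gprimeCptGL_mem_archLocal`).  So the conjugator in `G′_∞` is the ALL-COMPACT chart point `gprimeTorus α ∅ (Pi.single w (0, 0, π))`
  (the unit diagonal `1` at every `v ≠ w`), an element of `G′_∞` with no hypothesis; the identity needs only `w ∈ S′` and `w` a split-chart place (so that the `w`-component
  of `gprimeTorus α S′ c` IS the boost, ★ `coe_gprimeBlock_of_mem`).
* `g` is an INVOLUTION (`g · g = 1`: `D² = 1`), so `Ad(g)` normalises the chart torus `{gprimeTorus α S′ c}` and squares to the identity on it — the shape ★ p849838 uses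
  on the `H` side to get `Ad(n)_* dt = dt` (★ `map_conj_eq_self_of_conj_conj_eq`).
* §1 standard position: `exp_negXAngles` (`e^{i(0,0,π)_k} = (1, 1, −1)_k`), `diagonal_negX_mul_boostStd` (`D·B(c) = B(−x, φ, θ)·D`), `coe_gprimeCptGL_negX`,
  `gprimeCptGL_negX_mul_gprimeSplitGL` (the place chart, re-indexed by `τ`), `gprimeCptGL_negX_mul_self` (`D_τ² = 1`);
* §2 `G′_∞`: **`gprimeTorus_negX_mul`** (`g · γ′(c) = γ′(negXAt w c) · g`, `g = gprimeTorus α ∅ (Pi.single w (0,0,π))`), `gprimeTorus_negXConj_mul_self` (`g · g = 1`),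
  **`gprimeTorus_negXAt_eq_conj`**, **`exists_conj_gprimeTorus_negXAt`** (the dealt signature, minus its idle `hα`), **`exists_involutive_conj_gprimeTorus_negXAt`**
  (`∃ g, g · g = 1 ∧ ∀ c, g · γ′(c) · g⁻¹ = γ′(negXAt w c)` — the ★ p849838 shape).
All statements are generic in the `DecidableEq` instance on the complex places that `negXAt` ∕ `Pi.single` read (binder `[DecidableEq _]`), so they rewrite under any
consumer's instance.  HONEST LABEL: HC_CM is proved only modulo the 7 printed citations (2 remaining: hLiu418 = `stmt-HodgeConjecture-24832`, h413 =
`stmt-HodgeConjecture-24833`) until rung 0 closes; this file discharges nothing printed (+0∕+0).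

## References
* [Rogawski1990] J. D. Rogawski, *Automorphic Representations of Unitary Groups in Three Variables*, Ann. of Math. Stud. 123 (1990), §3.6 p. 31 (Cartan subgroups of
  `U(2,1)` and their Weyl groups), §4.3 (4.3.1) p. 43 (orbital integrals are class functions).
* [Knapp1986] A. W. Knapp, *Representation Theory of Semisimple Groups* (1986), Ch. V §3 (the `MA` torus of `SU(2,1)`; the real Weyl group of a split torus contains the
  reflection in the real root).
* [Shelstad1979] D. Shelstad, *Characters and inner forms of a quasi-split group over ℝ*, Compositio Math. 39 (1979), §4 p. 23 (realised vs. imaginary Weyl reflections).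
-/

set_option autoImplicit false

noncomputable section

open NumberField NumberField.InfinitePlace Matrix Complex
open scoped MatrixGroups Matrix ComplexConjugate Real

namespace Literature.NumberTheory.Automorphic.UnitaryGroup

open Literature.NumberTheory.Automorphic.ArchCartan

/-! ## §1 Standard position: the realised reflection `D = diag(1, 1, −1)` of the boost plane -/

section Standard

/-- The phases of the angle triple `(0, 0, π)`: `e^{i·0} = 1`, `e^{i·0} = 1`, `e^{iπ} = −1`. [cite: Knapp1986, Ch. V §3] -/
theorem exp_negXAngles (k : Fin 3) : Complex.exp ((((![0, 0, π] : Fin 3 → ℝ) k : ℝ) : ℂ) * I) = (![1, 1, -1] : Fin 3 → ℂ) k := by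
  fin_cases k
  · simp
  · simp
  · simp [Complex.exp_pi_mul_I]

/-- **`D · B(b; x, φ, θ) = B(b; −x, φ, θ) · D`**, `D = diag(1, 1, −1)`: the sign matrix of the boost plane realises `x ↦ −x` on the standard boost (`cosh` is even,
`sinh` is odd). [cite: Knapp1986, Ch. V §3] [cite: Rogawski1990, §3.6 p. 31] -/
theorem diagonal_negX_mul_boostStd (b c : Fin 3 → ℝ) :
    Matrix.diagonal (![1, 1, -1] : Fin 3 → ℂ) * boostStd b c = boostStd b ![-c 0, c 1, c 2] * Matrix.diagonal (![1, 1, -1] : Fin 3 → ℂ) := by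
  ext i j
  fin_cases i <;> fin_cases j <;>
    simp [boostStd, Matrix.diagonal_mul, Matrix.mul_diagonal, Real.cosh_neg, Real.sinh_neg, -Complex.ofReal_cosh, -Complex.ofReal_sinh]

variable (τ : Fin 3 ≃ Fin 3) (a : Fin 3 → ℝ)

/-- The compact-chart point `gprimeCptGL τ (0, 0, π)` is the re-indexed sign matrix: `diag(ℓ ↦ (1, 1, −1)_{τ⁻¹ ℓ})` (`−1` on the odd line `τ 2`). [cite: Rogawski1990, §3.6 p. 31] -/
theorem coe_gprimeCptGL_negX :
    ((gprimeCptGL τ ![0, 0, π] : GL (Fin 3) ℂ) : Matrix (Fin 3) (Fin 3) ℂ) = Matrix.diagonal fun ℓ => (![1, 1, -1] : Fin 3 → ℂ) (τ.symm ℓ) := by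
  rw [coe_gprimeCptGL]
  congr 1
  funext ℓ
  exact exp_negXAngles (τ.symm ℓ)

/-- The place version (matrices): `D_τ · gprimeSplitMatrix τ a (x, φ, θ) = gprimeSplitMatrix τ a (−x, φ, θ) · D_τ`, `D_τ = gprimeCptGL τ (0, 0, π)`.
[cite: Knapp1986, Ch. V §3] [cite: Rogawski1990, §3.6 p. 31] -/
theorem coe_gprimeCptGL_negX_mul_gprimeSplitMatrix (c : Fin 3 → ℝ) :
    ((gprimeCptGL τ ![0, 0, π] : GL (Fin 3) ℂ) : Matrix (Fin 3) (Fin 3) ℂ) * gprimeSplitMatrix τ a c =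
      gprimeSplitMatrix τ a ![-c 0, c 1, c 2] * ((gprimeCptGL τ ![0, 0, π] : GL (Fin 3) ℂ) : Matrix (Fin 3) (Fin 3) ℂ) := by
  rw [coe_gprimeCptGL_negX]
  ext i j
  have h := congrFun (congrFun (diagonal_negX_mul_boostStd (a ∘ τ) c) (τ.symm i)) (τ.symm j)
  simp only [Matrix.diagonal_mul, Matrix.mul_diagonal] at h
  simp only [Matrix.diagonal_mul, Matrix.mul_diagonal, gprimeSplitMatrix, Matrix.submatrix_apply]
  exact h

/-- **The place version in `GL₃(ℂ)`**: `gprimeCptGL τ (0,0,π) · gprimeSplitGL τ a (x, φ, θ) = gprimeSplitGL τ a (−x, φ, θ) · gprimeCptGL τ (0,0,π)`.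
[cite: Knapp1986, Ch. V §3] [cite: Rogawski1990, §3.6 p. 31] -/
theorem gprimeCptGL_negX_mul_gprimeSplitGL (c : Fin 3 → ℝ) :
    gprimeCptGL τ ![0, 0, π] * gprimeSplitGL τ a c = gprimeSplitGL τ a ![-c 0, c 1, c 2] * gprimeCptGL τ ![0, 0, π] := by
  refine Matrix.GeneralLinearGroup.ext fun i j => ?_
  rw [Units.val_mul, Units.val_mul, coe_gprimeSplitGL, coe_gprimeSplitGL, coe_gprimeCptGL_negX_mul_gprimeSplitMatrix]

/-- **`D_τ · D_τ = 1`**: the realised reflection is an involution. [cite: Knapp1986, Ch. V §3] -/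
theorem gprimeCptGL_negX_mul_self : gprimeCptGL τ ![0, 0, π] * gprimeCptGL τ ![0, 0, π] = 1 := by
  refine Matrix.GeneralLinearGroup.ext fun i j => ?_
  rw [Units.val_mul, coe_gprimeCptGL_negX, Matrix.diagonal_mul_diagonal, Units.val_one, ← Matrix.diagonal_one, Matrix.diagonal_apply, Matrix.diagonal_apply]
  by_cases hij : i = j
  · rw [if_pos hij, if_pos hij]
    generalize τ.symm i = k
    fin_cases k <;> simp
  · rw [if_neg hij, if_neg hij]

end Standard

/-! ## §2 `G′_∞`: the reflection `negXAt w` at a split place of the chart `S′` is conjugation by `gprimeTorus α ∅ (Pi.single w (0, 0, π))` -/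

section GPrime

variable (L : Type) [Field L] [NumberField L] [IsCMField L] (α : Fin 3 → L) [DecidableEq {w : InfinitePlace L // IsComplex w}]
  (S' : Finset {w : InfinitePlace L // IsComplex w})

variable {S'} in
/-- **`g · γ′(c) = γ′(negXAt w c) · g`** for `γ′ = gprimeTorus α S′`, `w ∈ S′` a split-chart place, `g = gprimeTorus α ∅ (Pi.single w (0, 0, π))` (the sign matrix of
the boost plane at `w`, the identity at every other place): componentwise through ★ `archPiEquivCM` — at `w` §1, at `v ≠ w` both sides are the `v`-component of `γ′(c)`
(`negXAt w c v = c v`). [cite: Knapp1986, Ch. V §3] [cite: Rogawski1990, §3.6 p. 31] [cite: Shelstad1979, §4 p. 23] -/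
theorem gprimeTorus_negX_mul {w : {w : InfinitePlace L // IsComplex w}} (hw : w ∈ S') (hsp : w ∈ splitChartPlaces L α)
    (c : {w : InfinitePlace L // IsComplex w} → Fin 3 → ℝ) :
    gprimeTorus L α ∅ (Pi.single w ![0, 0, π]) * gprimeTorus L α S' c =
      gprimeTorus L α S' (negXAt w c) * gprimeTorus L α ∅ (Pi.single w ![0, 0, π]) := by
  unfold gprimeTorus
  rw [← map_mul, ← map_mul]
  congr 1
  funext v
  rw [Pi.mul_apply, Pi.mul_apply]
  apply Subtype.ext
  rw [Subgroup.coe_mul, Subgroup.coe_mul]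
  by_cases hv : v = w
  · subst hv
    rw [coe_gprimeBlock_of_not_mem L α _ (Finset.notMem_empty v), coe_gprimeBlock_of_mem L α _ hw hsp, coe_gprimeBlock_of_mem L α _ hw hsp,
      Pi.single_eq_same, negXAt_apply_self]
    exact gprimeCptGL_negX_mul_gprimeSplitGL _ _ (c v)
  · rw [coe_gprimeBlock_of_not_mem L α _ (Finset.notMem_empty v), Pi.single_eq_of_ne hv, gprimeCptGL_zero, one_mul, mul_one]
    unfold gprimeBlock
    simp only [negXAt_apply_of_ne hv]

/-- **`g · g = 1`** for the conjugator `g = gprimeTorus α ∅ (Pi.single w (0, 0, π))` (componentwise `D_τ² = 1` at `w`, `1 · 1 = 1` elsewhere). [cite: Knapp1986, Ch. V §3] -/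
theorem gprimeTorus_negXConj_mul_self (w : {w : InfinitePlace L // IsComplex w}) :
    gprimeTorus L α ∅ (Pi.single w ![0, 0, π]) * gprimeTorus L α ∅ (Pi.single w ![0, 0, π]) = 1 := by
  unfold gprimeTorus
  rw [← map_mul, ← map_one (archPiEquivCM 3 L (Matrix.diagonal α)).symm]
  congr 1
  funext v
  rw [Pi.mul_apply, Pi.one_apply]
  apply Subtype.ext
  rw [Subgroup.coe_mul, Subgroup.coe_one, coe_gprimeBlock_of_not_mem L α _ (Finset.notMem_empty v)]
  by_cases hv : v = w
  · subst hv
    rw [Pi.single_eq_same]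
    exact gprimeCptGL_negX_mul_self _
  · rw [Pi.single_eq_of_ne hv, gprimeCptGL_zero, one_mul]

variable {S'} in
/-- **`γ′(negXAt w c) = g · γ′(c) · g⁻¹`** with the explicit conjugator `g = gprimeTorus α ∅ (Pi.single w (0, 0, π)) ∈ G′_∞`. [cite: Knapp1986, Ch. V §3]
[cite: Rogawski1990, §3.6 p. 31] -/
theorem gprimeTorus_negXAt_eq_conj {w : {w : InfinitePlace L // IsComplex w}} (hw : w ∈ S') (hsp : w ∈ splitChartPlaces L α)
    (c : {w : InfinitePlace L // IsComplex w} → Fin 3 → ℝ) :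
    gprimeTorus L α S' (negXAt w c) =
      gprimeTorus L α ∅ (Pi.single w ![0, 0, π]) * gprimeTorus L α S' c * (gprimeTorus L α ∅ (Pi.single w ![0, 0, π]))⁻¹ := by
  rw [eq_mul_inv_iff_mul_eq, gprimeTorus_negX_mul L α hw hsp c]

variable {S'} in
/-- **THE SPLIT REFLECTION IS REALISED IN `G′_∞`** (the dealt (NEGX-CONJ) head; its `hα : ∀ i, α i ≠ 0` is not needed): for a chart `S′` of split-chart places and
`w ∈ S′`, `gprimeTorus α S′ (negXAt w c)` is `G′_∞`-conjugate to `gprimeTorus α S′ c` — so every orbital integral on `G′_∞` takes the same value at the two points.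
[cite: Rogawski1990, §3.6 p. 31; §4.3 (4.3.1) p. 43] [cite: Knapp1986, Ch. V §3] [cite: Shelstad1979, §4 p. 23] -/
theorem exists_conj_gprimeTorus_negXAt (hS' : ∀ w, w ∈ S' → w ∈ splitChartPlaces L α) {w : {w : InfinitePlace L // IsComplex w}} (hw : w ∈ S')
    (c : {w : InfinitePlace L // IsComplex w} → Fin 3 → ℝ) :
    ∃ g : ↥(arch (↥(maximalRealSubfield L)) L (IsCMField.complexConj L) 3 (Matrix.diagonal α)),
      g * gprimeTorus L α S' c * g⁻¹ = gprimeTorus L α S' (negXAt w c) :=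
  ⟨gprimeTorus L α ∅ (Pi.single w ![0, 0, π]), (gprimeTorus_negXAt_eq_conj L α hw (hS' w hw) c).symm⟩

variable {S'} in
/-- **THE REALISED REFLECTION AS AN INVOLUTION OF `G′_∞` NORMALISING THE CHART TORUS** (the ★ p849838 shape on the `G′` side): for `w ∈ S′` a split-chart place there is
`g ∈ G′_∞` with `g · g = 1` and `g · gprimeTorus α S′ c · g⁻¹ = gprimeTorus α S′ (negXAt w c)` for EVERY `c` — so `Ad(g)` preserves the chart torus and squares to the
identity on it (whence `Ad(g)_* dt = dt` for its Haar measure, as in ★ `map_conj_eq_self_of_conj_conj_eq`). [cite: Shelstad1979, §4 p. 23] [cite: Rogawski1990, §3.6 p. 31]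
[cite: Knapp1986, Ch. V §3] -/
theorem exists_involutive_conj_gprimeTorus_negXAt {w : {w : InfinitePlace L // IsComplex w}} (hw : w ∈ S') (hsp : w ∈ splitChartPlaces L α) :
    ∃ g : ↥(arch (↥(maximalRealSubfield L)) L (IsCMField.complexConj L) 3 (Matrix.diagonal α)),
      g * g = 1 ∧ ∀ c : {w : InfinitePlace L // IsComplex w} → Fin 3 → ℝ, g * gprimeTorus L α S' c * g⁻¹ = gprimeTorus L α S' (negXAt w c) :=
  ⟨gprimeTorus L α ∅ (Pi.single w ![0, 0, π]), gprimeTorus_negXConj_mul_self L α w, fun c => (gprimeTorus_negXAt_eq_conj L α hw hsp c).symm⟩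

end GPrime


end Literature.NumberTheory.Automorphic.UnitaryGroup

end
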